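import Summits.QuantumAdvantage.AdviceFreeQNC0.TwistBoundEval
import Summits.QuantumAdvantage.AdviceFreeQNC0.WindowLocalHard
import HarnessLib

/-!
# Cell qa-qnc0, `p = 3` — twisted walk sums of WALK-WINDOW-LOCAL (and hidden-state-aware) strategies decay: `TwistBoundStateLocal`

The u-frame companion of `BondTwist3.twistBoundX3Local` (qn-prover-3 g22; `r`-local LETTER rules).  A walk strategy
`Y : Fin (n+1) → (Fin n → Bool) → Bool` is

* WINDOW-LOCAL of radius `r` (`WindowLocal r Y`, planner qa-qnc0-p2 g13 / p1's rung R1): `Y g` reads the walk bits `u_i`,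
  `g − r ≤ i < g + r` — strictly MORE than an `r`-local letter rule (letters `x_j = ¬(u_j ⊕ u_{j−1})` are local in `u`, but a
  walk bit is a prefix parity of the letters);
* STATE-AWARE WINDOW-LOCAL (`StateWindowLocal r Y`): `Y g u = F (st u g) g u` with each `F ρ` window-local — the bell may ALSO
  read the hidden walk state `st u g ∈ ℤ/3` at its own cut (p2's "hidden-binned marks").

The register chain (`RegState r` = position, spin `u_{i−1}`, last `2r` letters) DECODES all of this: at site `i` the walk bits
`u_{i−1−2r}, …, u_{i−1}` (`backSpin_stU`) and the state `st u (i−r)` (`backPos_stU`); at the end the bits `u_0..u_{2r−1}` from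
the letter prefix (`uFwd_eq`) and `u_{n−1−2r}..u_{n−1}` from the final state.  So state-aware window-local strategies admit correct
evaluators (`midSpec_state`, `finSpec_state`) and `TwistBoundEval` applies:

* **`twistBoundStateLocal : TwistBoundStateLocal`** — `∀ r ∃ A, ρ < 1 ∀ n c Y, StateWindowLocal r Y → ‖Σ_u e₃(γ·x(u))·[WIN_c(Y)(u)]‖ ≤ A·ρ^{#supp γ}·2ⁿ`;
* **`twistBoundStateLocalQ : TwistBoundStateLocalQ`** — radius-uniform constants `A = 9e^{1/32}`, rate `exp(−(#supp γ − 4r)/(32(2r+1)³))`;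
* `twistBoundWalkLocal`, `twistBoundWalkLocalQ` — the `WindowLocal` special cases.

WHAT THIS IS NOT: the rung consuming this (polylog-many common MOD₃ gates ⊗ walk windows) is in `CommonGatesHardPolylog.lean`;
crux 22907 untouched; no separation.
-/

noncomputable section

namespace Summit.QuantumAdvantage.AdviceFreeQNC0

open Finset Literature.Computability.MetaComplexity Literature.Computability.QuantumComplexity

namespace BondTwist3

open TransferWalk ConstBells TwistedTransfer

variable {n r : ℕ}

/-! ## Statements -/

/-- `Y` is STATE-AWARE WINDOW-LOCAL of radius `r`: `Y g u = F (st u g) g u` with every `F ρ` window-local of radius `r`. -/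
def StateWindowLocal (r : ℕ) (Y : Fin (n + 1) → (Fin n → Bool) → Bool) : Prop :=
  ∃ F : ZMod 3 → Fin (n + 1) → (Fin n → Bool) → Bool, (∀ ρ, WindowLocal r (F ρ)) ∧ ∀ g u, Y g u = F (st u g.val) g u

/-- Window-local strategies are state-aware window-local (ignore the state). -/
theorem stateWindowLocal_of_windowLocal {Y : Fin (n + 1) → (Fin n → Bool) → Bool} (h : WindowLocal r Y) :
    StateWindowLocal r Y :=
  ⟨fun _ => Y, fun _ => h, fun _ _ => rfl⟩

/-- **`TwistBoundStateLocal`**: twisted walk sums of state-aware window-local strategies decay exponentially in `#supp γ`, at a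
rate depending on the radius only, for every length and every charge. -/
def TwistBoundStateLocal : Prop :=
  ∀ r : ℕ, ∃ A ρ : ℝ, ρ < 1 ∧ ∀ (n c : ℕ) (Y : Fin (n + 1) → (Fin n → Bool) → Bool), StateWindowLocal r Y →
    ∀ γ : Fin (n + 1) → ZMod 3,
      ‖∑ u : Fin n → Bool, (ZMod.stdAddChar (∑ i : Fin (n + 1), if xOfU u i then γ i else 0) : ℂ) *
          (if ringWinU c Y u = true then (1 : ℂ) else 0)‖
        ≤ A * ρ ^ (univ.filter fun i : Fin (n + 1) => γ i ≠ 0).card * (2 : ℝ) ^ n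

/-- **`TwistBoundStateLocalQ`**: the same with radius-uniform constants. -/
def TwistBoundStateLocalQ : Prop :=
  ∃ A c₀ : ℝ, 0 < c₀ ∧ ∀ (r n c : ℕ) (Y : Fin (n + 1) → (Fin n → Bool) → Bool), StateWindowLocal r Y →
    ∀ γ : Fin (n + 1) → ZMod 3,
      ‖∑ u : Fin n → Bool, (ZMod.stdAddChar (∑ i : Fin (n + 1), if xOfU u i then γ i else 0) : ℂ) *
          (if ringWinU c Y u = true then (1 : ℂ) else 0)‖
        ≤ A * (64 : ℝ) ^ r *
            Real.exp (-(c₀ * (((univ.filter fun i : Fin (n + 1) => γ i ≠ 0).card : ℝ) - 4 * r) / (2 * (r : ℝ) + 1) ^ 3)) *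
          (2 : ℝ) ^ n

/-! ## Decoding the walk bits -/

/-- The walk bits seen at the middle site `i` (state `σ` before letter `i`): `u_j` for `i − 1 − 2r ≤ j ≤ i − 1`, decoded backwards
from the spin through the register; `false` elsewhere. -/
def midBits (i : ℕ) (σ : RegState r) : Fin n → Bool :=
  fun j => if j.val + 1 ≤ i ∧ i ≤ j.val + 1 + 2 * r then backSpin σ (i - 1 - j.val) else false

/-- On the true trajectory the bits seen ARE the walk bits, on `[i − 1 − 2r, i − 1]`. -/
theorem midBits_stU (u : Fin n → Bool) {i : ℕ} (hi : i ≤ n) (j : Fin n) (h1 : j.val + 1 ≤ i) (h2 : i ≤ j.val + 1 + 2 * r) :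
    midBits i (stU r u i) j = u j := by
  unfold midBits
  rw [if_pos ⟨h1, h2⟩, backSpin_stU u hi (i - 1 - j.val) (by omega) (by omega),
    show i - 1 - (i - 1 - j.val) = j.val by omega, NPGamma37Proof.uExt_of_lt u j.isLt]

/-- The walk bits seen at the end (letter prefix `a`, final state `σ`): `u_j` for `j < 2r` (forward from the prefix) and for
`n − 1 − 2r ≤ j` (backwards from the final state); `false` elsewhere. -/
def finBits (a : Fin (2 * r) → Bool) (σ : RegState r) : Fin n → Bool :=
  fun j => if j.val < 2 * r then uFwd a (j.val + 1)
    else if n ≤ j.val + 1 + 2 * r then backSpin σ (n - 1 - j.val) else false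

/-- On the true trajectory the bits seen at the end ARE the walk bits, on `[0, 2r) ∪ [n − 1 − 2r, n)`. -/
theorem finBits_stU {a : Fin (2 * r) → Bool} (u : Fin n → Bool) (hrn : 2 * r ≤ n) (ha : HasPrefix a u) (j : Fin n)
    (hj : j.val < 2 * r ∨ n ≤ j.val + 1 + 2 * r) : finBits a (stU r u n) j = u j := by
  unfold finBits
  by_cases h1 : j.val < 2 * r
  · rw [if_pos h1, uFwd_eq hrn ha (j.val + 1) (by omega)]
    unfold sPrev
    rw [if_neg (by omega), Nat.add_sub_cancel, NPGamma37Proof.uExt_of_lt u j.isLt]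
  · rw [if_neg h1, if_pos (by omega), backSpin_stU u le_rfl (n - 1 - j.val) (by omega) (by omega),
      show n - 1 - (n - 1 - j.val) = j.val by omega, NPGamma37Proof.uExt_of_lt u j.isLt]

/-! ## The evaluators of a state-aware window-local strategy -/

/-- Middle evaluator: bell `i − r` of `F`, at the decoded state `backPos σ r = st u (i − r)`, on the decoded bits. -/
def emS (F : ZMod 3 → Fin (n + 1) → (Fin n → Bool) → Bool) (i : ℕ) (σ : RegState r) (_b : Bool) : Bool :=
  yN (F (backPos σ r)) (i - r) (midBits i σ)

/-- Final evaluator: boundary bell `k` of `F`, at the state `posB n a σ k = st u k`, on the decoded bits. -/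
def efS (F : ZMod 3 → Fin (n + 1) → (Fin n → Bool) → Bool) (a : Fin (2 * r) → Bool) (σ : RegState r) (k : ℕ) : Bool :=
  yN (F (posB n a σ k)) k (finBits a σ)

/-- **The middle evaluator is correct.** -/
theorem midSpec_state {Y : Fin (n + 1) → (Fin n → Bool) → Bool} {F : ZMod 3 → Fin (n + 1) → (Fin n → Bool) → Bool}
    (hF : ∀ ρ, WindowLocal r (F ρ)) (hY : ∀ g u, Y g u = F (st u g.val) g u) : MidSpec (r := r) Y (emS F) := by
  intro u i h2r hi
  unfold emS yN
  have hlt : i - r < n + 1 := by omega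
  rw [dif_pos hlt, dif_pos hlt, backPos_stU u hi.le r (by omega) (by omega), hY]
  exact hF _ ⟨i - r, hlt⟩ _ _ fun j hj1 hj2 => midBits_stU u hi.le j (by simp only at hj2; omega) (by simp only at hj1; omega)

/-- **The final evaluator is correct.** -/
theorem finSpec_state {Y : Fin (n + 1) → (Fin n → Bool) → Bool} {F : ZMod 3 → Fin (n + 1) → (Fin n → Bool) → Bool}
    (hF : ∀ ρ, WindowLocal r (F ρ)) (hY : ∀ g u, Y g u = F (st u g.val) g u) : FinSpec (r := r) Y (efS F) := by
  intro a u hn ha k hkn hk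
  unfold efS yN
  have hlt : k < n + 1 := by omega
  rw [dif_pos hlt, dif_pos hlt, hY]
  have hpos : posB n a (stU r u n) k = st u k := by
    unfold posB
    by_cases hkr : k < r
    · rw [if_pos hkr, stFwd_eq (by omega) ha k (by omega)]
    · rw [if_neg hkr, backPos_stU u le_rfl (n - k) (by omega) (by omega), show n - (n - k) = k by omega]
  rw [hpos]
  refine hF _ ⟨k, hlt⟩ _ _ fun j hj1 hj2 => finBits_stU u (by omega) ha j ?_
  simp only at hj1 hj2
  omega

/-- State-aware window-local strategies admit correct evaluators. -/
theorem eval_of_stateWindowLocal {Y : Fin (n + 1) → (Fin n → Bool) → Bool} (h : StateWindowLocal r Y) :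
    ∃ (em : ℕ → RegState r → Bool → Bool) (ef : (Fin (2 * r) → Bool) → RegState r → ℕ → Bool),
      MidSpec Y em ∧ FinSpec Y ef := by
  obtain ⟨F, hF, hY⟩ := h
  exact ⟨emS F, efS F, midSpec_state hF hY, finSpec_state hF hY⟩

/-! ## The theorems -/

/-- **`twistBoundStateLocal : TwistBoundStateLocal` — PROVED.** -/
theorem twistBoundStateLocal : TwistBoundStateLocal := by
  intro r
  obtain ⟨A, ρ, _, _, hρ1, h⟩ := twistBoundU_of_eval r
  exact ⟨A, ρ, hρ1, fun n c Y hY γ => h n c Y (eval_of_stateWindowLocal hY) γ⟩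

/-- **`twistBoundStateLocalQ : TwistBoundStateLocalQ` — PROVED** (`A = 9e^{1/32}`, `c₀ = 1/32`). -/
theorem twistBoundStateLocalQ : TwistBoundStateLocalQ := by
  refine ⟨9 * Real.exp (1 / 32), 1 / 32, by norm_num, fun r n c Y hY γ => ?_⟩
  exact twistBoundUQ_of_eval r n c Y (eval_of_stateWindowLocal hY) γ

/-- **Window-local strategies** (constant radius): twisted walk sums decay in `#supp γ`. -/
theorem twistBoundWalkLocal (r : ℕ) : ∃ A ρ : ℝ, ρ < 1 ∧
    ∀ (n c : ℕ) (Y : Fin (n + 1) → (Fin n → Bool) → Bool), WindowLocal r Y → ∀ γ : Fin (n + 1) → ZMod 3,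
      ‖∑ u : Fin n → Bool, (ZMod.stdAddChar (∑ i : Fin (n + 1), if xOfU u i then γ i else 0) : ℂ) *
          (if ringWinU c Y u = true then (1 : ℂ) else 0)‖
        ≤ A * ρ ^ (univ.filter fun i : Fin (n + 1) => γ i ≠ 0).card * (2 : ℝ) ^ n := by
  obtain ⟨A, ρ, hρ1, h⟩ := twistBoundStateLocal r
  exact ⟨A, ρ, hρ1, fun n c Y hY γ => h n c Y (stateWindowLocal_of_windowLocal hY) γ⟩

/-- **Window-local strategies, radius-uniform constants.** -/
theorem twistBoundWalkLocalQ : ∃ A c₀ : ℝ, 0 < c₀ ∧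
    ∀ (r n c : ℕ) (Y : Fin (n + 1) → (Fin n → Bool) → Bool), WindowLocal r Y → ∀ γ : Fin (n + 1) → ZMod 3,
      ‖∑ u : Fin n → Bool, (ZMod.stdAddChar (∑ i : Fin (n + 1), if xOfU u i then γ i else 0) : ℂ) *
          (if ringWinU c Y u = true then (1 : ℂ) else 0)‖
        ≤ A * (64 : ℝ) ^ r *
            Real.exp (-(c₀ * (((univ.filter fun i : Fin (n + 1) => γ i ≠ 0).card : ℝ) - 4 * r) / (2 * (r : ℝ) + 1) ^ 3)) *
          (2 : ℝ) ^ n := by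
  obtain ⟨A, c₀, hc₀, h⟩ := twistBoundStateLocalQ
  exact ⟨A, c₀, hc₀, fun r n c Y hY γ => h r n c Y (stateWindowLocal_of_windowLocal hY) γ⟩

end BondTwist3

end Summit.QuantumAdvantage.AdviceFreeQNC0

end
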